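import Summits.Ventures.PercRepro.ProfilePointedCircuitClassesInOutTriangle
import Summits.Ventures.PercRepro.ProfilePointedCircuitClassesInOutTriangleII
import Summits.Ventures.PercRepro.ProfilePointedCircuitClassesInOutTriangleIII

/-!
# PercRepro — THE SINGLE-TRIANGLE CASE OF `InOutBottomFour`, IV: THE ASSEMBLY, MODULO THE «BOTTOM ≤ TOP − 2»
COMPARISON `(G)` OF A NULLITY-3 MATROID MARKED BY A PAIR (p5, gen 38; `proofs/P5-GM1.md` §54 ADDENDA 2–3)

`(G)` (`MixedPairBottomTopTwo`, a CONJECTURE def, NOT asserted): on a nullity-3 matroid `M` without loops or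
coloops, for every independent pair `{f, g}` and `H₀ := E − f − g`,
`#{Y ⊆ H₀ : #Y = 3, Y ∈ ℐ, (H₀ − Y) + f + g ∈ ℐ} ≤ #{Y ⊆ H₀ : #Y = 3, Y + f + g ∈ ℐ, H₀ − Y ∈ ℐ}` —
exhaustively true at `#E = 9` (every nullity-3 matroid on `9` points without loops or coloops, 33,383 pairs), 0
failures on random matroids up to `13` points, and a per-flat statement about the rank-`≤ 2` flats of `M*`
(§54 ADDENDUM 3 (2)).

**THEOREM** (`inCount_four_le_outCount_five_of_triangle`): modulo `(G)`, on `#E = ρ + 4`, `ρ ≥ 7`, `E − e` without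
loops or coloops, at every point `e` whose only circuit with `≤ ρ − 1` elements is a triangle `{e, f, g}` (every
independent `(ρ − 2)`-subset of `E − e` capturing `e` contains `f` and `g`), `in_4(e) ≤ out_5(e)`: the demands split
as `in_4(e) ≤ #D₀ + #D_f + #D_g` (TriangleII), the units as `#U_{fg} + #U_f + #U_g ≤ out_5(e)` (TriangleIII),
`#D_f ≤ #U_f` and `#D_g ≤ #U_g` are `mixedTwo_le_mixedFour_of_nullity_three` on the deletion `N ∖ e` (InOutTriangle),
and `#D₀ ≤ #U_{fg}` is `(G)` on `N ∖ e`.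
-/

open scoped Matroid

namespace PercRepro.Cogirth

open Finset ThmH Skew Shadow Profile

variable {α : Type} [DecidableEq α]

section TriangleAssembly

/-- **THE «BOTTOM ≤ TOP − 2» COMPARISON OF A NULLITY-3 MATROID MARKED BY A PAIR** (a `Prop`; a CONJECTURE, NOT
asserted; §54 ADDENDA 2–3): on every nullity-3 matroid `M` (`#E = ρ + 3`, `ρ ≥ 6`) without loops or coloops, for
every independent pair `{f, g}` with `H₀ := E − f − g`, the `3`-subsets `Y` of `H₀` with `Y ∈ ℐ` and
`(H₀ − Y) + f + g ∈ ℐ` are at most the `3`-subsets `Y` with `Y + f + g ∈ ℐ` and `H₀ − Y ∈ ℐ`.  Exhaustively true at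
`#E = 9`, 0 failures at random up to `13` points, tight; no proof yet. -/
def MixedPairBottomTopTwo (α : Type) [DecidableEq α] : Prop :=
  ∀ (M : Matroid α) [M.Finite] (f g : α), f ∈ gr M → g ∈ gr M → f ≠ g →
    (gr M).card = rk M (gr M) + 3 → 6 ≤ rk M (gr M) →
    (∀ x ∈ gr M, rk M {x} = 1) → (∀ x ∈ gr M, rk M ((gr M).erase x) = rk M (gr M)) → rk M {f, g} = 2 →
    (((((gr M).erase f).erase g).powersetCard 3).filter (fun Y => rk M Y = 3 ∧
        rk M (((gr M).erase f).erase g \ Y ∪ {f, g}) = (((gr M).erase f).erase g \ Y ∪ {f, g}).card)).card ≤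
    (((((gr M).erase f).erase g).powersetCard 3).filter (fun Y => rk M (Y ∪ {f, g}) = 5 ∧
        rk M (((gr M).erase f).erase g \ Y) = (((gr M).erase f).erase g \ Y).card)).card

variable {N : Matroid α} [N.Finite]

omit [DecidableEq α] in
/-- A filtered count only depends on the predicate on the set (used to transport ranks in `N ∖ e` to ranks in `N`). -/
theorem card_filter_delete_eq {s : Finset (Finset α)} {P Q : Finset α → Prop} [DecidablePred P]
    [DecidablePred Q] (h : ∀ Y ∈ s, (P Y ↔ Q Y)) : (s.filter P).card = (s.filter Q).card := by
  rw [filter_congr h]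

/-- **THE SINGLE-TRIANGLE CASE OF `InOutBottomFour`, MODULO `(G)`**: on `#E = ρ(E) + 4`, `ρ(E) ≥ 7`, with `E − e`
free of loops and coloops, at a point `e` with a triangle `{e, f, g}` (`ρ{f, g} = 2`, `e ∈ cl{f, g}`) such that every
independent `(ρ − 2)`-subset of `E − e` capturing `e` contains `f` and `g`, `in_4(e) ≤ out_5(e)`. -/
theorem inCount_four_le_outCount_five_of_triangle (hG : MixedPairBottomTopTwo α)
    (hn : (gr N).card = rk N (gr N) + 4) (hR : 7 ≤ rk N (gr N)) {e f g : α}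
    (he : e ∈ gr N) (hf : f ∈ gr N) (hg : g ∈ gr N) (hef : e ≠ f) (heg : e ≠ g) (hfg : f ≠ g)
    (hnc : rk N ((gr N).erase e) = rk N (gr N))
    (hll : ∀ x ∈ (gr N).erase e, rk N {x} = 1)
    (hcf : ∀ x ∈ (gr N).erase e, rk N (((gr N).erase e).erase x) = rk N (gr N))
    (hfg2 : rk N {f, g} = 2) (htri : e ∈ clF N {f, g})
    (honly : ∀ X ⊆ (gr N).erase e, X.card + 2 = rk N (gr N) → rk N X = X.card → e ∈ clF N X → f ∈ X ∧ g ∈ X) :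
    inCount N 4 e ≤ outCount N 5 e := by
  have hf' : f ∈ (gr N).erase e := mem_erase.2 ⟨hef.symm, hf⟩
  have hg' : g ∈ (gr N).erase e := mem_erase.2 ⟨heg.symm, hg⟩
  have h1 := inCount_four_le_card_demands_of_triangle (N := N) (e := e) (f := f) (g := g) htri
  have h2 := card_demands_le_of_triangle (N := N) (e := e) hf' hg' hfg
  have h3 := card_units_ge_of_triangle (N := N) (e := e) hf' hg' hfg
  have h4 := card_units_le_outCount_five_of_triangle (N := N) hn he honly
  -- the deletion `M := N ∖ e`
  have hgr : gr (N ＼ ({e} : Set α)) = (gr N).erase e := gr_delete'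
  have hrkM : rk (N ＼ ({e} : Set α)) ((gr N).erase e) = rk N (gr N) := by
    rw [rk_delete (M := N) (e := e) (Subset.refl ((gr N).erase e))]
    exact hnc
  have hnM : (gr (N ＼ ({e} : Set α))).card = rk (N ＼ ({e} : Set α)) (gr (N ＼ ({e} : Set α))) + 3 := by
    rw [hgr, hrkM, card_erase_of_mem he]
    omega
  have hRM : 7 ≤ rk (N ＼ ({e} : Set α)) (gr (N ＼ ({e} : Set α))) := by
    rw [hgr, hrkM]
    exact hR
  have hfM : f ∈ gr (N ＼ ({e} : Set α)) := by rw [hgr]; exact hf'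
  have hgM : g ∈ gr (N ＼ ({e} : Set α)) := by rw [hgr]; exact hg'
  have hH₀ : (((gr N).erase e).erase f).erase g ⊆ (gr N).erase e := (erase_subset _ _).trans (erase_subset _ _)
  have hsubE : ∀ Y ⊆ (((gr N).erase e).erase f).erase g, Y ⊆ (gr N).erase e := fun Y hY => hY.trans hH₀
  -- `(G)` on the deletion
  have hG' := hG (N ＼ ({e} : Set α)) f g hfM hgM hfg hnM (by omega)
    (fun x hx => by rw [hgr] at hx; rw [rk_delete (M := N) (e := e) (singleton_subset_iff.2 hx)]; exact hll x hx)
    (fun x hx => by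
      rw [hgr] at hx
      rw [hgr, rk_delete (M := N) (e := e) (erase_subset _ _), hrkM]
      exact hcf x hx)
    (by rw [rk_delete (M := N) (e := e) (insert_subset hf' (singleton_subset_iff.2 hg'))]; exact hfg2)
  rw [hgr] at hG'
  have hGt1 := card_filter_delete_eq (s := ((((gr N).erase e).erase f).erase g).powersetCard 3)
      (P := fun Y => rk (N ＼ ({e} : Set α)) Y = 3 ∧
        rk (N ＼ ({e} : Set α)) ((((gr N).erase e).erase f).erase g \ Y ∪ {f, g}) = ((((gr N).erase e).erase f).erase g \ Y ∪ {f, g}).card)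
      (Q := fun Y => rk N Y = 3 ∧
        rk N ((((gr N).erase e).erase f).erase g \ Y ∪ {f, g}) = ((((gr N).erase e).erase f).erase g \ Y ∪ {f, g}).card)
      (fun Y hY => by
        rw [mem_powersetCard] at hY
        rw [rk_delete (M := N) (e := e) (hsubE Y hY.1),
          rk_delete (M := N) (e := e) (union_subset (sdiff_subset.trans hH₀) (insert_subset hf' (singleton_subset_iff.2 hg')))])
  have hGt2 := card_filter_delete_eq (s := ((((gr N).erase e).erase f).erase g).powersetCard 3)
      (P := fun Y => rk (N ＼ ({e} : Set α)) (Y ∪ {f, g}) = 5 ∧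
        rk (N ＼ ({e} : Set α)) ((((gr N).erase e).erase f).erase g \ Y) = ((((gr N).erase e).erase f).erase g \ Y).card)
      (Q := fun Y => rk N (Y ∪ {f, g}) = 5 ∧
        rk N ((((gr N).erase e).erase f).erase g \ Y) = ((((gr N).erase e).erase f).erase g \ Y).card)
      (fun Y hY => by
        rw [mem_powersetCard] at hY
        rw [rk_delete (M := N) (e := e) (union_subset (hsubE Y hY.1) (insert_subset hf' (singleton_subset_iff.2 hg'))),
          rk_delete (M := N) (e := e) (sdiff_subset.trans hH₀)])
  rw [hGt1, hGt2] at hG'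
  -- `(F)` on the deletion, for `(f, g)` and for `(g, f)`
  have hgcM : rk (N ＼ ({e} : Set α)) ((gr (N ＼ ({e} : Set α))).erase g) = rk (N ＼ ({e} : Set α)) (gr (N ＼ ({e} : Set α))) := by
    rw [hgr, rk_delete (M := N) (e := e) (erase_subset _ _), hrkM]
    exact hcf g hg'
  have hfcM : rk (N ＼ ({e} : Set α)) ((gr (N ＼ ({e} : Set α))).erase f) = rk (N ＼ ({e} : Set α)) (gr (N ＼ ({e} : Set α))) := by
    rw [hgr, rk_delete (M := N) (e := e) (erase_subset _ _), hrkM]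
    exact hcf f hf'
  have hF1 := mixedTwo_le_mixedFour_of_nullity_three (M := N ＼ ({e} : Set α)) hnM hRM hfM hgM hfg hgcM
  have hF2 := mixedTwo_le_mixedFour_of_nullity_three (M := N ＼ ({e} : Set α)) hnM hRM hgM hfM hfg.symm hfcM
  rw [hgr] at hF1 hF2
  have hFt1 := card_filter_delete_eq (s := ((((gr N).erase e).erase f).erase g).powersetCard 2)
      (P := fun Y => rk (N ＼ ({e} : Set α)) (insert f Y) = 3 ∧
        rk (N ＼ ({e} : Set α)) (insert g ((((gr N).erase e).erase f).erase g \ Y)) = (insert g ((((gr N).erase e).erase f).erase g \ Y)).card)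
      (Q := fun Y => rk N (insert f Y) = 3 ∧
        rk N (insert g ((((gr N).erase e).erase f).erase g \ Y)) = (insert g ((((gr N).erase e).erase f).erase g \ Y)).card)
      (fun Y hY => by
        rw [mem_powersetCard] at hY
        rw [rk_delete (M := N) (e := e) (insert_subset hf' (hsubE Y hY.1)),
          rk_delete (M := N) (e := e) (insert_subset hg' (sdiff_subset.trans hH₀))])
  have hFt2 := card_filter_delete_eq (s := ((((gr N).erase e).erase f).erase g).powersetCard 4)
      (P := fun Y => rk (N ＼ ({e} : Set α)) (insert f Y) = 5 ∧
        rk (N ＼ ({e} : Set α)) (insert g ((((gr N).erase e).erase f).erase g \ Y)) = (insert g ((((gr N).erase e).erase f).erase g \ Y)).card)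
      (Q := fun Y => rk N (insert f Y) = 5 ∧
        rk N (insert g ((((gr N).erase e).erase f).erase g \ Y)) = (insert g ((((gr N).erase e).erase f).erase g \ Y)).card)
      (fun Y hY => by
        rw [mem_powersetCard] at hY
        rw [rk_delete (M := N) (e := e) (insert_subset hf' (hsubE Y hY.1)),
          rk_delete (M := N) (e := e) (insert_subset hg' (sdiff_subset.trans hH₀))])
  rw [hFt1, hFt2] at hF1
  -- `H₀` for `(g, f)` is `((E − e) − g) − f`, the same set
  have hH₀' : (((gr N).erase e).erase g).erase f = (((gr N).erase e).erase f).erase g := by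
    ext a; simp only [mem_erase]; tauto
  rw [hH₀'] at hF2
  have hFt3 := card_filter_delete_eq (s := ((((gr N).erase e).erase f).erase g).powersetCard 2)
      (P := fun Y => rk (N ＼ ({e} : Set α)) (insert g Y) = 3 ∧
        rk (N ＼ ({e} : Set α)) (insert f ((((gr N).erase e).erase f).erase g \ Y)) = (insert f ((((gr N).erase e).erase f).erase g \ Y)).card)
      (Q := fun Y => rk N (insert g Y) = 3 ∧
        rk N (insert f ((((gr N).erase e).erase f).erase g \ Y)) = (insert f ((((gr N).erase e).erase f).erase g \ Y)).card)
      (fun Y hY => by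
        rw [mem_powersetCard] at hY
        rw [rk_delete (M := N) (e := e) (insert_subset hg' (hsubE Y hY.1)),
          rk_delete (M := N) (e := e) (insert_subset hf' (sdiff_subset.trans hH₀))])
  have hFt4 := card_filter_delete_eq (s := ((((gr N).erase e).erase f).erase g).powersetCard 4)
      (P := fun Y => rk (N ＼ ({e} : Set α)) (insert g Y) = 5 ∧
        rk (N ＼ ({e} : Set α)) (insert f ((((gr N).erase e).erase f).erase g \ Y)) = (insert f ((((gr N).erase e).erase f).erase g \ Y)).card)
      (Q := fun Y => rk N (insert g Y) = 5 ∧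
        rk N (insert f ((((gr N).erase e).erase f).erase g \ Y)) = (insert f ((((gr N).erase e).erase f).erase g \ Y)).card)
      (fun Y hY => by
        rw [mem_powersetCard] at hY
        rw [rk_delete (M := N) (e := e) (insert_subset hg' (hsubE Y hY.1)),
          rk_delete (M := N) (e := e) (insert_subset hf' (sdiff_subset.trans hH₀))])
  rw [hFt3, hFt4] at hF2
  omega

end TriangleAssembly

end PercRepro.Cogirth
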